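import Literature.Computability.MetaComplexity.NWLexicodeDesigns
import HarnessLib

/-!
# Linear-universe NW designs from the greedy code: the `4^r` parameters, universe `[n · 4^r]`

Topic `Computability/MetaComplexity`. A thin parameter layer over the computable greedy design
`lexDesign` of `NWLexicodeDesigns.lean` (Nisan–Wigderson 1994, Lemma 2.5; Arora–Barak 2009,
Lemma 20.14), in the shape consumed by the formalisation of Hirahara's reduction
(`Complexity/HiraharaInstance.lean`: designs indexed into a universe `Fin d`, intersections a
`1/r` fraction of the block size): for `r ≥ 2`, `n ≥ 1` and `N ≤ 2ⁿ` blocks, the words over the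
alphabet `[4^r]` with pairwise agreement `≤ n/r` are numerous enough
(`NWLexLinear.condition_pow4`), and the graph blocks, pushed into `Fin (n · 4^r)` by
`finProdFinEquiv`, form an `IsNWDesign (n/r)` family (`NWLexLinear.linDesign`,
`NWLexLinear.isNWDesign_linDesign`, via `IsNWDesign.trans` of `NWGenerator.lean`). Nearest in-tree prior
art for this regime: `Complexity/NWQuickPRG.lean`, `design_condition` / `le_length_lexWords_param`
(block size `a·t`, alphabet `2^{a+1}`, intersections `t`); the delta of this layer is: arbitrary block
size `n` (not a multiple of `r`), alphabet `4^r`, every `N ≤ 2ⁿ`, and the flat universe `Fin (n·4^r)`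
that `HiraharaInstance.lean` wants.

## References

* N. Nisan, A. Wigderson, *Hardness vs randomness*, JCSS 49 (1994), Lemma 2.5 [NisanWigderson1994].
* S. Arora, B. Barak, *Computational Complexity: A Modern Approach*, CUP 2009, Lemma 20.14
  [AroraBarakCC2009].
-/

namespace Literature.Computability.MetaComplexity

open Finset

namespace NWLexLinear

/-- **The counting condition of the greedy code for the `4^r` parameters**: for `r ≥ 2`, `n ≥ 1`,
`N ≤ 2ⁿ`: `N · 2ⁿ · (4^r)^{n - (n/r + 1)} ≤ (4^r)ⁿ`. [cite: AroraBarakCC2009, Lemma 20.14 (parameters); NisanWigderson1994, Lemma 2.5] -/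
theorem condition_pow4 {r n N : ℕ} (hr : 2 ≤ r) (hn : 1 ≤ n) (hN : N ≤ 2 ^ n) :
    N * (2 ^ n * (4 ^ r) ^ (n - (n / r + 1))) ≤ (4 ^ r) ^ n := by
  set d := n / r with hd
  have hdn : d + 1 ≤ n := by
    have : d < n := Nat.div_lt_self hn hr
    omega
  -- `(4^r)^n = (4^r)^{n-(d+1)} · (4^r)^{d+1}` and `N 2ⁿ ≤ 4ⁿ ≤ 4^{r(d+1)}`
  have hsplit : (4 ^ r) ^ n = (4 ^ r) ^ (n - (d + 1)) * (4 ^ r) ^ (d + 1) := by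
    rw [← pow_add, Nat.sub_add_cancel hdn]
  have hkey : N * 2 ^ n ≤ (4 ^ r) ^ (d + 1) := by
    have h1 : n < r * (d + 1) := by rw [hd]; exact Nat.lt_mul_div_succ n (by omega)
    calc N * 2 ^ n ≤ 2 ^ n * 2 ^ n := Nat.mul_le_mul_right _ hN
      _ = 4 ^ n := by rw [← mul_pow]; norm_num
      _ ≤ 4 ^ (r * (d + 1)) := Nat.pow_le_pow_right (by norm_num) h1.le
      _ = (4 ^ r) ^ (d + 1) := by rw [pow_mul]
  calc N * (2 ^ n * (4 ^ r) ^ (n - (d + 1))) = (4 ^ r) ^ (n - (d + 1)) * (N * 2 ^ n) := by ring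
    _ ≤ (4 ^ r) ^ (n - (d + 1)) * (4 ^ r) ^ (d + 1) := Nat.mul_le_mul_left _ hkey
    _ = (4 ^ r) ^ n := hsplit.symm

/-- Enough greedy words for the `4^r` parameters. [cite: AroraBarakCC2009, Lemma 20.14] -/
theorem le_length_lexWords_pow4 {r n N : ℕ} (hr : 2 ≤ r) (hn : 1 ≤ n) (hN : N ≤ 2 ^ n) :
    N ≤ (lexWords n (4 ^ r) (n / r)).length :=
  le_length_lexWords (by positivity) (Nat.div_lt_self hn hr) (condition_pow4 hr hn hN)

/-- **The linear design**: `N ≤ 2ⁿ` blocks of size `n` in the universe `Fin (n · 4^r)` (graph blocks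
of the greedy code words, through `finProdFinEquiv`). [cite: NisanWigderson1994, Lemma 2.5; AroraBarakCC2009, Lemma 20.14] -/
def linDesign (r n N : ℕ) (hr : 2 ≤ r) (hn : 1 ≤ n) (hN : N ≤ 2 ^ n) (i : Fin N) : Fin n ↪ Fin (n * 4 ^ r) :=
  (lexDesign n (4 ^ r) (n / r) N (le_length_lexWords_pow4 hr hn hN) i).trans finProdFinEquiv.toEmbedding

/-- The linear design is an NW design with intersections `≤ n/r`. [cite: NisanWigderson1994, Lemma 2.5; AroraBarakCC2009, Lemma 20.14] -/
theorem isNWDesign_linDesign {r n N : ℕ} (hr : 2 ≤ r) (hn : 1 ≤ n) (hN : N ≤ 2 ^ n) :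
    IsNWDesign (n / r) (linDesign r n N hr hn hN) :=
  (isNWDesign_lexDesign _).trans _

end NWLexLinear

end Literature.Computability.MetaComplexity
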